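import Summits.BirchSwinnertonDyer.BirchSwinnertonDyer.Theorems.GenusKolyvaginAtTwoGenusPrimitiveSupplyAtTwoPosDiscShallowSilentReductionBit
import Summits.BirchSwinnertonDyer.BirchSwinnertonDyer.Theorems.GenusKolyvaginAtTwoGenusDeepSupplyAtTwoNegDiscNarrowDepthZeroLocalKummerReading
import Literature.NumberTheory.EllipticCurves.HeegnerPointsKolyvaginPairing
import Literature.NumberTheory.GaloisRepresentations.AbsGaloisOuterConj
import HarnessLib

/-!
# Route `GenusKolyvaginAtTwo`, crux K₄⁻ `K4Neg` (stmt-BirchSwinnertonDyer-31526), the phantom cell F4ᵖᵍ — THE HEEGNER DESCENT BIT,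
# part 2: THE CORE — at a ramified prime where the phantom is alive, NO anti-invariant `K`-point has the phantom as its Kummer class

Seat `bsd-line-gk2-p3` g34 (PROVER seat 3/3, cell `bsd-f1-sign2`), `--supports stmt-BirchSwinnertonDyer-31526 --as helper`.
THEOREMS ONLY (no definition, no named fact, no `sorry`); standard axioms; UNCONDITIONAL.  **BSD is NOT proved by this file; K4Neg
is NOT proved; nothing is closed.**

THE STATEMENT (`false_of_antiInvariant_kummer_eq_h1Eval`, `Γ_ℚ`-currency on `E(ℚ̄) = W.geomPoints`).  `E = W/ℚ` globally minimal,
`ℓ = p` an odd prime of good reduction, `𝔓` the prime of `\bar ℤ` of the tree's place over `ℓ`, `K` a quadratic field with `ℓ ∣ d_K`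
(`e : K → ℚ̄` the tree's embedding, `res Γ_K ≤ Γ_ℚ` its stabiliser), `E(ℚ)[2] = 0` (no `Γ_ℚ`-fixed non-zero `2`-torsion), a class
`x ∈ H¹(ℚ, E[2])` dying on `Γ_{ℚ(E[4])}` (so UNRAMIFIED at `ℓ`), and an arithmetic Frobenius `F` at `𝔓` with `F·F ∈ Γ_{ℚ(E[2])}` and
**`[x, F·F] ≠ 0`** (the phantom is ALIVE at `ℓ`: the frames supplied by `…PhantomCellDescentBitSupply`).  THEN for no point `A ∈ E(K)`
with `τA = −A` (`τ` the non-trivial automorphism of `K`) and no half `Q₀ ∈ E(ℚ̄)`, `2Q₀ = e_* A`, is the `K`-Kummer cocycle of `Q₀`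
cohomologous on `res Γ_K` to the chosen cocycle of `x`:  ¬ ∃ `v₀ ∈ E[2]`, ∀ `ρ ∈ res Γ_K`, `ρQ₀ − Q₀ = [x, ρ] + (ρv₀ − v₀)`.

WHY THIS IS THE DESCENT BIT.  LEAD gk2-p1 g28's `hDesc` (p786172 §1) on a prime frame `K = ℚ(√−ℓ₀)` of the K₄⁻ cell says that the
Kummer classes of (multiples of) `y_K` over `K` miss the `K`-phantoms `{0, res_K ξ_E}` (Lawson–Wuthrich over `K`, gk2-p4 g31 KLW).  On
that cell `E(ℚ)` is finite of odd order and `E(K)[2] = 0`, so `E(K) ⊗ ℤ₂` is generated by an ANTI-invariant point; the present theorem is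
exactly «`κ^K(A) ≠ res_K ξ_E`» once the `K`-side class equality is unfolded to `E(ℚ̄)` (part 3, `…PhantomCellDescentBit`).

THE PROOF (twin-free; no local field; reduction mod `𝔓` only).  Put `Q' = Q₀ − v₀`, so `ρQ' − Q' = [x, ρ]` on `res Γ_K` and `2Q' = e_*A`.
Let `γ ∈ I_𝔓` act on `e(K)` as `τ` (gk2-p5 g33 `exists_mem_inertia_smul_absEmbedding_eq`).  (1) `D := γQ' + Q'` is `2`-torsion
(`γ e_*A = e_*(τA) = −e_*A`), fixed by `γ` (`γ² ∈ res Γ_K`, `[x, γ²] = [x,γ] + γ[x,γ] = 0` as `I_𝔓 ≤ Γ_{ℚ(E[4])}` kills `x`) and by `res Γ_K`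
(cocycle identity of `[x,·]` at `σγ = γ·(γ⁻¹σγ)`), hence by `Γ_ℚ = res Γ_K ∪ γ·res Γ_K`: `D = 0`, i.e. `γQ' = −Q'`.  (2) Inertia acts trivially on
`Ẽ(𝔽̄_ℓ)`: `2·red Q' = 0` (LEAD gk2-p1 g21 `two_smul_geomReduction_eq_zero_of_inertia_anti`), so `red Q' = red w` for some `w ∈ E[2]` (gk2-p5 g34
`exists_twoTorsion_geomReduction_eq`).  (3) `F² ∈ D_𝔓` preserves the kernel of reduction (gk2-p5 `geomReduction_smul_eq_zero_iff_of_mem_decompositionSubgroup`)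
and fixes `w`, so `red(F²Q' − Q') = red(F²(Q' − w)) − red(Q' − w) = 0`; but `F²Q' − Q' = [x, F²] ∈ E[2]` and `red` is injective on `E[2]`
(Silverman VII.3.1(b)): `[x, F²] = 0`, contradiction.

* §1 `mem_torsionFixing_of_mem_inertia_placeOver` — `I_𝔓 ≤ Γ_{ℚ(E[n])}` for `ℓ ∤ n` (`E[n]` unramified at a good `ℓ`), via `red`.
* §2 `h1Eval_mul_smul` — the cocycle identity `[x, ρρ'] = [x,ρ] + ρ[x,ρ']` for the chosen cocycle (any `ρ, ρ'`).
* §3 ★ `false_of_antiInvariant_kummer_eq_h1Eval`.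

References: [LawsonWuthrich2016] §7.1 (the phantom class), §3; [Serre1972] §1.11 Prop. 11 (proof: inertia and Frobenius on `Ẽ`);
[SilvermanAEC2009] VII.3.1(b), VIII.§1–§2 (Kummer pairing); [GrossLMS1991] §9 Prop. 9.1 (the pairing `[s, ρ]`); [Neukirch1999] I §9 (Hilbert theory).
-/

set_option linter.dupNamespace false -- tree convention: `Summit.BirchSwinnertonDyer.BirchSwinnertonDyer.Theorems` (summit = sub-problem)
set_option autoImplicit false

noncomputable section

open scoped Classical NumberField Pointwise

namespace Summit.BirchSwinnertonDyer.BirchSwinnertonDyer.Theorems.GenusExact.PhantomDescentBit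

open WeierstrassCurve NumberField IsDedekindDomain Field
open Literature.NumberTheory.GaloisRepresentations Literature.NumberTheory.EllipticCurves Rat.HeightOneSpectrum
open Summit.BirchSwinnertonDyer.BirchSwinnertonDyer.Theorems.GenusSupplyNarrow
open Summit.BirchSwinnertonDyer.BirchSwinnertonDyer.Theorems.GenusSupplyNarrow.DepthZero
open Summit.BirchSwinnertonDyer.BirchSwinnertonDyer.Theorems.GenusSupplyNarrow.DepthZeroSilent

/-! ## §1 Inertia at a good prime `ℓ ∤ n` fixes `E[n]` (place currency) -/

section Inertia

variable {W : WeierstrassCurve ℚ} [W.IsGloballyMinimal] [W.IsElliptic] {p : ℕ} [Fact p.Prime]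
  (hΔ : ¬ (p : ℤ) ∣ minimalDiscriminantInt W)
  {𝔓 : Ideal (absIntegers (𝓞 ℚ) ℚ)}
  (hmem : ∀ x : absIntegers (𝓞 ℚ) ℚ, x ∈ 𝔓 ↔ (x : AlgebraicClosure ℚ) ∈ (placeOver p).nonunits)

include hΔ hmem in
/-- **`I_𝔓 ≤ Γ_{ℚ(E[n])}` for a good prime `p ∤ n`** (`E[n]` is unramified at `p`; Silverman VII.4.1): for `γ ∈ I_𝔓` and `T ∈ E[n]`,
`γT − T` is `n`-torsion and reduces to `Õ` (inertia acts trivially on `Ẽ`, Serre), hence is `O` (`red` is injective on prime-to-`p` torsion).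
[cite: SilvermanAEC2009, Prop. VII.4.1 and VII.3.1(b)] [cite: Serre1972, §1.11, Prop. 11 (proof)] -/
theorem mem_torsionFixing_of_mem_inertia_placeOver {γ : absoluteGaloisGroup ℚ} (hγ : γ ∈ 𝔓.inertia (absoluteGaloisGroup ℚ))
    {n : ℕ} (hn : ¬ p ∣ n) : γ ∈ torsionFixing W (n : ℤ) := by
  rw [mem_torsionFixing_iff]
  intro T
  apply Subtype.ext
  rw [Literature.NumberTheory.EllipticCurves.AddSubgroup.torsionBy.coe_smul]
  have hT : (n : ℤ) • (T : W.geomPoints) = 0 := (mem_geomTorsion_iff W (n : ℤ) _).mp T.2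
  have h0 : n • (γ • (T : W.geomPoints) - T) = 0 := by
    rw [← natCast_zsmul, smul_sub, ← smul_zsmul_geomPoints', hT, smul_zero, sub_zero]
  have hred : geomReduction hΔ (γ • (T : W.geomPoints) - T) = 0 := by
    rw [map_sub, geomReduction_smul_of_mem_inertia (p := p) hΔ hmem hγ, sub_self]
  exact sub_eq_zero.mp (eq_zero_of_smul_eq_zero_of_geomReduction_eq_zero hΔ hn h0 hred)

end Inertia

/-! ## §2 The cocycle identity of the chosen cocycle -/

section Cocycle

variable {K : Type} [Field K] (W : WeierstrassCurve K) (n : ℤ)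

/-- **`[x, ρρ'] = [x, ρ] + ρ • [x, ρ']`** for ALL `ρ, ρ' ∈ Γ_K` — the crossed-homomorphism identity of the CHOSEN cocycle `reprCocycle x`
(whose values `h1Eval x ·` are; off `Γ_{K(E[n])}` the values depend on the choice, the identity does not). [cite: SerreGaloisCohomology1997, I.§5.1] -/
theorem h1Eval_mul_smul (x : galH1Torsion W n) (ρ ρ' : absoluteGaloisGroup K) :
    h1Eval W n x (ρ * ρ') = h1Eval W n x ρ + ρ • h1Eval W n x ρ' := by
  have h := (reprCocycle W n x).2 ρ ρ'
  rw [discreteTopRep_ρ_apply] at h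
  exact h

end Cocycle

/-! ## §3 The core: an anti-invariant point cannot have the (alive) phantom as its `K`-Kummer class -/

section Core

variable {W : WeierstrassCurve ℚ} [W.IsGloballyMinimal] [W.IsElliptic] {p : ℕ} [Fact p.Prime]
  (hΔ : ¬ (p : ℤ) ∣ minimalDiscriminantInt W)
  {𝔓 : Ideal (absIntegers (𝓞 ℚ) ℚ)}
  (hmem : ∀ x : absIntegers (𝓞 ℚ) ℚ, x ∈ 𝔓 ↔ (x : AlgebraicClosure ℚ) ∈ (placeOver p).nonunits)

include hΔ hmem in
/-- ★ **THE CORE OF THE HEEGNER DESCENT BIT.**  `E = W/ℚ` globally minimal elliptic; `p` an ODD prime of good reduction, `𝔓 ∣ p` the prime of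
the tree's place (`hmem`), `v` the place of `ℚ` under it; `K` quadratic with `p ∣ d_K` (RAMIFIED), `e = absEmbedding ℚ K`; no non-zero `2`-torsion
point of `E(ℚ̄)` is fixed by `Γ_ℚ`; `x ∈ H¹(ℚ, E[2])` dying on `Γ_{ℚ(E[4])}`; `F` an arithmetic Frobenius at `𝔓` with `F·F ∈ Γ_{ℚ(E[2])}` and
`[x, F·F] ≠ 0`.  Then for every `A ∈ E(K)` ANTI-invariant under `Aut(K/ℚ)`, every `Q₀ ∈ E(ℚ̄)` with `2Q₀ = e_*A` and every `v₀ ∈ E[2]`, it is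
FALSE that `ρQ₀ − Q₀ = [x, ρ] + (ρv₀ − v₀)` for all `ρ ∈ res Γ_K` — the `K`-Kummer class of `A` is NOT the restriction of `x`.  Proof in the
module docstring ((1) `γQ' = −Q'` at an inertia element `γ` lifting `τ`, from `E(ℚ)[2] = 0`; (2) `2·red Q' = 0`; (3) `red([x,F²]) = 0`).
[cite: LawsonWuthrich2016, §7.1] [cite: Serre1972, §1.11, Prop. 11 (proof)] [cite: SilvermanAEC2009, VII.3.1(b), VIII.§2] [cite: GrossLMS1991, §9 Prop. 9.1] -/
theorem false_of_antiInvariant_kummer_eq_h1Eval (hp2 : p ≠ 2)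
    {v : HeightOneSpectrum (𝓞 ℚ)} (hv : (primesEquiv v : ℕ) = p) (h𝔓 : 𝔓 ∈ v.primesAbove)
    {K : Type} [Field K] [NumberField K] (h2 : Module.finrank ℚ K = 2) (hpK : (p : ℤ) ∣ NumberField.discr K)
    (h2Q : ∀ u : geomTorsion W (2 : ℤ), (∀ ρ : absoluteGaloisGroup ℚ, ρ • u = u) → u = 0)
    {x : galH1Torsion W (2 : ℤ)} (hx4 : ∀ h ∈ torsionFixing W (4 : ℤ), h1Eval W (2 : ℤ) x h = 0)
    {F : absoluteGaloisGroup ℚ} (hF : IsArithFrobAt (𝓞 ℚ) F 𝔓) (hF2 : F * F ∈ torsionFixing W (2 : ℤ))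
    (hval : h1Eval W (2 : ℤ) x (F * F) ≠ 0)
    {A : (W.baseChange K).toAffine.Point} (hA : ∀ τ : K ≃ₐ[ℚ] K, τ ≠ 1 → τ • A = -A)
    {Q₀ : W.geomPoints} (hQ₀ : (2 : ℤ) • Q₀ = Affine.Point.map (W' := W) (absEmbedding ℚ K) A)
    {v₀ : W.geomPoints} (hv₀ : (2 : ℤ) • v₀ = 0)
    (hyp : ∀ ρ ∈ (absGaloisRestrict ℚ K).range,
      ρ • Q₀ - Q₀ = (h1Eval W (2 : ℤ) x ρ : W.geomPoints) + (ρ • v₀ - v₀)) : False := by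
  have hp : p.Prime := Fact.out
  have hp2' : ¬ p ∣ 2 := fun h ↦ hp2 ((Nat.prime_dvd_prime_iff_eq hp Nat.prime_two).mp h)
  have hp4 : ¬ p ∣ 4 := fun h ↦ hp2' (by
    have : p ∣ 2 * 2 := by simpa using h
    exact (hp.dvd_mul.mp this).elim id id)
  -- ### the quadratic field: `Aut(K/ℚ) = {1, τ}`, the hom `Γ_ℚ → Aut(K/ℚ)`, the subgroup `S = res Γ_K`
  haveI : Algebra.IsQuadraticExtension ℚ K := ⟨h2⟩
  haveI : IsGalois ℚ K := inferInstance
  have hcard : Nat.card (K ≃ₐ[ℚ] K) = 2 := by rw [IsGalois.card_aut_eq_finrank, h2]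
  set q := absGaloisQuot ℚ K with hq
  have hqe : ∀ (ρ : absoluteGaloisGroup ℚ) (k : K), ρ • absEmbedding ℚ K k = absEmbedding ℚ K (q ρ k) :=
    fun ρ k ↦ (absEmbedding_absGaloisQuot_apply ℚ K ρ k).symm
  have hS : ∀ ρ : absoluteGaloisGroup ℚ, ρ ∈ (absGaloisRestrict ℚ K).range ↔ q ρ = 1 := fun ρ ↦
    (absGaloisQuot_eq_one_iff ℚ K ρ).symm
  -- the inertia element `γ` acting on `e(K)` as the non-trivial `τ`
  obtain ⟨γ, hγI, τ, hτ1, hγe⟩ := exists_mem_inertia_smul_absEmbedding_eq h2 hpK hv h𝔓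
  have hqγ : q γ = τ := by
    apply AlgEquiv.ext
    intro k
    exact (absEmbedding ℚ K).injective (((hqe γ k).symm).trans (hγe k))
  have hττ : τ * τ = 1 := by
    rcases Literature.NumberTheory.QuadraticFields.eq_one_or_eq_of_card_eq_two hcard hτ1 (τ * τ) with h | h
    · exact h
    · exact absurd (mul_left_cancel (a := τ) (h.trans (mul_one τ).symm)) hτ1
  have hq01 : ∀ ρ : absoluteGaloisGroup ℚ, q ρ = 1 ∨ q ρ = τ := fun ρ ↦
    Literature.NumberTheory.QuadraticFields.eq_one_or_eq_of_card_eq_two hcard hτ1 (q ρ)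
  -- membership facts in `S`
  have hγS : γ ∉ (absGaloisRestrict ℚ K).range := fun h ↦ hτ1 (hqγ ▸ (hS γ).mp h)
  have hγγS : γ * γ ∈ (absGaloisRestrict ℚ K).range := by rw [hS, map_mul, hqγ, hττ]
  have hFFS : F * F ∈ (absGaloisRestrict ℚ K).range := by
    rw [hS, map_mul]
    rcases hq01 F with h | h
    · rw [h, mul_one]
    · rw [h, hττ]
  have hsplit : ∀ ρ : absoluteGaloisGroup ℚ, ρ ∈ (absGaloisRestrict ℚ K).range ∨ γ⁻¹ * ρ ∈ (absGaloisRestrict ℚ K).range := by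
    intro ρ
    rcases hq01 ρ with h | h
    · exact Or.inl ((hS ρ).mpr h)
    · right
      rw [hS, map_mul, map_inv, hqγ, h, inv_mul_cancel]
  have hconjS : ∀ σ ∈ (absGaloisRestrict ℚ K).range, γ⁻¹ * σ * γ ∈ (absGaloisRestrict ℚ K).range := by
    intro σ hσ
    rw [hS] at hσ ⊢
    rw [map_mul, map_mul, hσ, mul_one, map_inv, inv_mul_cancel]
  -- `Γ_ℚ`-equivariance of `e_*` and the (anti-)invariance of `e_* A`
  obtain ⟨Y, hY⟩ : ∃ Y : W.geomPoints, Y = Affine.Point.map (W' := W) (absEmbedding ℚ K) A := ⟨_, rfl⟩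
  rw [← hY] at hQ₀
  have hequiv : ∀ ρ : absoluteGaloisGroup ℚ, ρ • Y = Affine.Point.map (W' := W) (absEmbedding ℚ K) (q ρ • A) :=
    fun ρ ↦ smul_eq_map_absEmbedding_smul W (hqe ρ) A Y hY
  have hYS : ∀ σ ∈ (absGaloisRestrict ℚ K).range, σ • Y = Y := by
    intro σ hσ
    rw [hequiv, (hS σ).mp hσ, one_smul]
    exact hY.symm
  have hYγ : γ • Y = -Y := by
    rw [hequiv, hqγ, hA τ hτ1, map_neg, hY]
    rfl
  -- `γ ∈ Γ_{ℚ(E[4])}` and `Γ_{ℚ(E[2])}`: `[x, γ] = 0`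
  have hγ4 : γ ∈ torsionFixing W (4 : ℤ) := by
    have h := mem_torsionFixing_of_mem_inertia_placeOver hΔ hmem hγI (n := 4) hp4
    exact_mod_cast h
  have hγ2 : γ ∈ torsionFixing W (2 : ℤ) := by
    have h := mem_torsionFixing_of_mem_inertia_placeOver hΔ hmem hγI (n := 2) hp2'
    exact_mod_cast h
  have hxγ : h1Eval W (2 : ℤ) x γ = 0 := hx4 γ hγ4
  -- ### `Q' := Q₀ − v₀`: `2Q' = Y`, `ρQ' − Q' = [x, ρ]` on `S`
  obtain ⟨Q', hQ'⟩ : ∃ Q' : W.geomPoints, Q' = Q₀ - v₀ := ⟨_, rfl⟩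
  have h2Q' : (2 : ℤ) • Q' = Y := by rw [hQ', smul_sub, hv₀, sub_zero, hQ₀]
  have hyp' : ∀ σ ∈ (absGaloisRestrict ℚ K).range, σ • Q' - Q' = (h1Eval W (2 : ℤ) x σ : W.geomPoints) := by
    intro σ hσ
    rw [hQ', smul_sub, show σ • Q₀ - σ • v₀ - (Q₀ - v₀) = (σ • Q₀ - Q₀) - (σ • v₀ - v₀) by abel, hyp σ hσ]
    abel
  -- ### (1) `D := γQ' + Q'` vanishes
  obtain ⟨D, hD⟩ : ∃ D : W.geomPoints, D = γ • Q' + Q' := ⟨_, rfl⟩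
  have h2D : (2 : ℤ) • D = 0 := by
    rw [hD, smul_add, ← smul_zsmul_geomPoints', h2Q', hYγ, neg_add_cancel]
  -- `γ² Q' = Q'`
  have hγγQ : γ • γ • Q' = Q' := by
    have h := hyp' (γ * γ) hγγS
    rw [h1Eval_mul W _ x hγ2 γ, hxγ, add_zero, ZeroMemClass.coe_zero, sub_eq_zero, mul_smul] at h
    exact h
  have hγD : γ • D = D := by
    rw [hD, smul_add, hγγQ, add_comm]
  -- `σ D = D` for `σ ∈ S`
  have hSD : ∀ σ ∈ (absGaloisRestrict ℚ K).range, σ • D = D := by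
    intro σ hσ
    obtain ⟨σ', hσ'⟩ : ∃ σ' : absoluteGaloisGroup ℚ, σ' = γ⁻¹ * σ * γ := ⟨_, rfl⟩
    have hσ'S : σ' ∈ (absGaloisRestrict ℚ K).range := hσ' ▸ hconjS σ hσ
    have hσγ : σ * γ = γ * σ' := by rw [hσ']; group
    -- `σγQ' = γQ' + γ[x,σ']` and `γ[x,σ'] = [x, σγ] = [x,σ] = σQ' − Q'`
    have h1 : (σ * γ) • Q' = γ • Q' + γ • (h1Eval W (2 : ℤ) x σ' : W.geomPoints) := by
      rw [hσγ, mul_smul, ← hyp' σ' hσ'S, smul_sub]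
      abel
    have h2 : γ • (h1Eval W (2 : ℤ) x σ' : W.geomPoints) = (h1Eval W (2 : ℤ) x (σ * γ) : W.geomPoints) := by
      rw [hσγ, h1Eval_mul_smul W _ x γ σ', hxγ, zero_add, Literature.NumberTheory.EllipticCurves.AddSubgroup.torsionBy.coe_smul]
    have h3 : (h1Eval W (2 : ℤ) x (σ * γ) : W.geomPoints) = σ • Q' - Q' := by
      rw [h1Eval_mul_smul W _ x σ γ, hxγ, smul_zero, add_zero, hyp' σ hσ]
    have hσ2Q : σ • ((2 : ℤ) • Q') = (2 : ℤ) • Q' := by rw [h2Q', hYS σ hσ]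
    -- assemble
    have hσγQ : σ • γ • Q' = γ • Q' + (σ • Q' - Q') := by rw [← mul_smul, h1, h2, h3]
    rw [hD, smul_add, hσγQ]
    have h22 : σ • Q' + σ • Q' = Q' + Q' := by
      rw [← two_smul ℤ, ← two_smul ℤ (Q' : W.geomPoints)]
      simpa [smul_zsmul_geomPoints'] using hσ2Q
    have : γ • Q' + (σ • Q' - Q') + σ • Q' = γ • Q' + (σ • Q' + σ • Q') - Q' := by abel
    rw [this, h22]
    abel
  -- every `ρ ∈ Γ_ℚ` fixes `D`
  have hρD : ∀ ρ : absoluteGaloisGroup ℚ, ρ • D = D := by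
    intro ρ
    rcases hsplit ρ with h | h
    · exact hSD ρ h
    · have hρ : ρ = γ * (γ⁻¹ * ρ) := by group
      rw [hρ, mul_smul, hSD _ h, hγD]
  have hD0 : D = 0 := by
    have hmem2 : D ∈ geomTorsion W (2 : ℤ) := (mem_geomTorsion_iff W (2 : ℤ) D).mpr h2D
    have h := h2Q ⟨D, hmem2⟩ fun ρ ↦ Subtype.ext (by
      rw [Literature.NumberTheory.EllipticCurves.AddSubgroup.torsionBy.coe_smul]; exact hρD ρ)
    exact congrArg Subtype.val h
  -- ### (2) `γQ' = −Q'`, so `2 • red Q' = 0`, so `red Q' = red w` with `w ∈ E[2]`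
  have hγQ' : γ • Q' = -Q' := by
    rw [hD, add_eq_zero_iff_eq_neg] at hD0
    exact hD0
  have h2red : (2 : ℤ) • geomReduction hΔ Q' = 0 := two_smul_geomReduction_eq_zero_of_inertia_anti (p := p) hΔ hmem hγI hγQ'
  obtain ⟨w, hw2, hw⟩ := exists_twoTorsion_geomReduction_eq hΔ hp2 (geomReduction hΔ Q') h2red
  have hredQw : geomReduction hΔ (Q' - w) = 0 := by rw [map_sub, hw, sub_self]
  -- ### (3) `F² ∈ D_𝔓` preserves the kernel of reduction and fixes `w`
  haveI : 𝔓.IsPrime := h𝔓.1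
  have hFD : F ∈ 𝔓.decompositionSubgroup (absoluteGaloisGroup ℚ) := hF.mem_stabilizer
  have hFFD : F * F ∈ 𝔓.decompositionSubgroup (absoluteGaloisGroup ℚ) := mul_mem hFD hFD
  have hredFF : geomReduction hΔ ((F * F) • (Q' - w)) = 0 :=
    (geomReduction_smul_eq_zero_iff_of_mem_decompositionSubgroup hΔ hmem hFFD (Q' - w)).mpr hredQw
  have hFFw : (F * F) • w = w := by
    have hwmem : w ∈ geomTorsion W (2 : ℤ) := (mem_geomTorsion_iff W (2 : ℤ) w).mpr hw2
    have h := smul_eq_of_mem_torsionFixing W (2 : ℤ) hF2 ⟨w, hwmem⟩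
    exact congrArg Subtype.val h
  -- `red (F²Q' − Q') = 0`
  have hredR : geomReduction hΔ ((F * F) • Q' - Q') = 0 := by
    have hsplit' : (F * F) • Q' - Q' = (F * F) • (Q' - w) - (Q' - w) := by
      rw [smul_sub, hFFw]; abel
    rw [hsplit', map_sub, hredFF, hredQw, sub_zero]
  -- `F²Q' − Q' = [x, F²]` is `2`-torsion, reduces to `Õ`, hence is `O`
  have hR : (F * F) • Q' - Q' = (h1Eval W (2 : ℤ) x (F * F) : W.geomPoints) := hyp' (F * F) hFFS
  have h2R : 2 • ((F * F) • Q' - Q') = 0 := by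
    rw [hR, ← natCast_zsmul]
    exact_mod_cast (mem_geomTorsion_iff W (2 : ℤ) _).mp (h1Eval W (2 : ℤ) x (F * F)).2
  have hR0 : (F * F) • Q' - Q' = 0 := eq_zero_of_smul_eq_zero_of_geomReduction_eq_zero hΔ hp2' h2R hredR
  apply hval
  apply Subtype.ext
  rw [ZeroMemClass.coe_zero, ← hR, hR0]

end Core

end Summit.BirchSwinnertonDyer.BirchSwinnertonDyer.Theorems.GenusExact.PhantomDescentBit

end
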